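/-
COR-CM (cell pub-hodgecm2, stage 2 of the Hodge ladder) — Δ2 BRIDGE, VERSION-B item (1)(d) «THE PIECES AT THE TOWER DICTIONARY», SEQUEL:
the S1 binders of `nonempty_hcmPieces_ofTower` (`CorCM/D2Bridge/HcmPiecesAtTower.lean`) DISCHARGED from the landed S1 core
(✔ `CorCM/D2Bridge/HcmS1LiuCMRecord.lean`, d2bridge-prove-1) — anonymously, inside a `Nonempty` proof, so that no definition and no
review-lane file is on the path.  Seat prover-pub-hodgecm2-d2bridge-prove-8-g0-0 (pair d2bridge-prove-3).  THEOREMS ONLY; hole-free; OUTSIDE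
the frozen port manifest; nothing landed is edited or restated; no named fact, no `sorry`.
FRAMING: HC_CM is NOT proved; «Δ2 BRIDGE CLOSED» is NOT claimed; hLiu at the constructed objects is a READING (r8); no pointer ∕ count ∕ hM token.
-/
import Summits.HodgeConjecture.CorCM.D2Bridge.HcmPiecesAtTower
import Summits.HodgeConjecture.CorCM.D2Bridge.HcmS1LiuCMRecord
import Literature.NumberTheory.Automorphic.Liu2021.AppendixC.Prop413DataOfRestOne
import HarnessLib

/-!
# Δ2 bridge, pin (d), sequel: S1 discharged — Liu's own CM datum, anonymously

[Liu2021] Y. Liu, *Fourier–Jacobi cycles and arithmetic relative trace formula*, Camb. J. Math. **9** (2021) = arXiv:2102.11518.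

At `emb := AlgHom.id ℚ L`, `ιg := ι₁` (the pin's values) and base change along `ι₁`, the one-object rest's `A_μ` IS the `A` of the chosen
Def. 4.5 (2) datum `datum … M.Dμ` (by `rfl`), so prove-1's S1 core ✔ `exists_liuCMRecord_of_cmDatum` (`CorCM/D2Bridge/HcmS1LiuCMRecord.lean`)
applies to it: from Liu's eigenclass `α₀` (proof of Thm. 4.18, l. 2250) it yields a principal model `B` of `A_μ ⊗_{L,ι₁} ℂ`, an isogeny
`u : A_μ ⊗ ℂ ⟶ B`, an `𝓞_{M_μ}`-structure realising the INFLATED REFLEX TYPE `Ψ̃_μ` and the transported eigenclass `α'` with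
`(f ≫ u)^*_ℂ α' = f^*_ℂ α₀` — i.e. the binders `dLiu ∕ u ∕ hu` of `nonempty_hcmPieces_ofTower` with `dLiu q := ⟨↥K*_μ, Ψ*_μ, M_μ, e_μ, B, …,
(q : ℂ) • α'⟩`, chosen INSIDE the proof (the conclusion is a `Nonempty`, so no definition is needed).  The admissibility input becomes
`hadm`: EVERY record of that reflex shape is `adm i`-admissible — at the pin `adm i d := d.IsReflexOfTypeG ι₁ (typeOfLine (line i))`, and
prove-1's ✔ `admLiu_mk_of_eq` (`CorCM/D2Bridge/HcmS1PinAdm.lean`) discharges it from the X3-Char identification `Φ_{μ_i} = typeOfLine (line i)`.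
HC_CM is NOT proved; «Δ2 BRIDGE CLOSED» is NOT claimed.

## References
* [Liu2021] Y. Liu, arXiv:2102.11518 = Camb. J. Math. 9 (2021): Def. 4.3 (2) (FJcycle.tex l. 1919), Def. 4.5 (2) (l. 1944–1951),
  proof of Thm. 4.18 (l. 2246–2253), Thm. 4.18 (1) (l. 2239), Rem. 4.17, Lem. 2.4 (1).
* [Shimura1998] G. Shimura, *Abelian Varieties with Complex Multiplication and Modular Functions*, Princeton 1998, §7.1 Prop. 7, §8.3 Prop. 28.
-/

set_option autoImplicit false

noncomputable section

open scoped TensorProduct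

namespace Summit.HodgeConjecture.CorCM.D2Bridge

open CategoryTheory
open Literature.AlgebraicGeometry.Motives (SchemeOver AbelianVariety bettiCohomology)
open Literature.AlgebraicGeometry.HodgeTheory
open Literature.AlgebraicGeometry.HodgeTheory.BettiUniverse (pull)
open Literature.AlgebraicGeometry.ShimuraVarieties.UnitaryCanonicalModel
open Literature.NumberTheory.Automorphic Literature.NumberTheory.Automorphic.PicardCM
open Literature.NumberTheory.Automorphic.Liu2021 Literature.NumberTheory.Automorphic.Liu2021.AppendixC
open Literature.NumberTheory.Automorphic.Liu2021.AppendixC.RestOne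
open Literature.NumberTheory.Transcendental (Arapura2012_Cor_15_4_6)
open HodgeCM.Model HodgeCM.Model.TowerCarrier
open HodgeCM.Literature.Theta.LiuAlbaneseModuleDatum.D2Bridge (HcmPieces)

section PiecesAtTowerLiu

open Literature.AlgebraicGeometry.ComplexMultiplication
open Literature.NumberTheory.ComplexMultiplication
open Literature.NumberTheory.Automorphic.IdeleClassGroup

variable {hHD : exists_isReal_hodgeModel} {hI : hodgePQ_independent_of_hodgeModel}
  {h₁ : BallQuotientUniformised} {h₃ : CMAbelianVarietyRealised} {hA : Arapura2012_Cor_15_4_6}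
variable {L : HodgeCM.CMField} [IsGalois ℚ (L : Type)] {ι₁ : (L : Type) →+* ℂ} (V : HodgeCM.HermSpace3 L ι₁)
variable (Char : Type) (Adm : Char → Type) (Ω : (i : Char) → Adm i → Type)
  [∀ i a, AddCommGroup (Ω i a)] [∀ i a, Module ℂ (Ω i a)] [∀ i a, Module (adelicAlgebra V) (Ω i a)]
  [∀ i a, IsScalarTower ℂ (adelicAlgebra V) (Ω i a)] (PhiMu : Char → Prop) (adm : Char → LiuCMSide → Prop)
variable (h : exists_recordSystem) (Φ : Literature.AlgebraicGeometry.Motives.CMType L) {isotropicAt : ℕ → Prop}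
  (C : Sec42Data (Model.honestP5Of h ⟨L.K⟩ ι₁ ⟨V.Hm, V.isHermitian, V.signature_ι₁, V.posDef_of_ne⟩ Φ) isotropicAt)
variable {μ : Literature.NumberTheory.Automorphic.IdeleClassGroup (L : Type) →ₜ* Circle}
  (hμ : Literature.NumberTheory.Automorphic.IdeleClassGroup.IsConjugateSymplectic (L : Type) μ)
  (hw : Literature.NumberTheory.Automorphic.IdeleClassGroup.HasWeight (L : Type) μ 1) (Car : Def45.Carriers (L : Type) μ)
  (Eps : Type) (epsOf : L → Eps) (Chi : Type) (omega : Eps → Chi → Type)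
  [∀ ε χ, AddCommGroup (omega ε χ)] [∀ ε χ, Module ℂ (omega ε χ)]
  (rho : ∀ ε χ, Representation ℂ C.G (omega ε χ))
  (rhoΩ : Representation (fieldOfValues (L : Type) μ) C.G (ΩOne C (AlgHom.id ℚ (L : Type)) ι₁ hμ hw Car))

/-- **Δ2 BRIDGE, PIN (d) with S1 DISCHARGED: the pieces at the tower dictionary from the J-junction inputs, Liu's eigenclass and the
admissibility of the S1 record shape.**  As `nonempty_hcmPieces_ofTower` at the pin's `emb := AlgHom.id`, `ιg := ι₁`, base change along
`ι₁`, with the binders `dLiu ∕ u ∕ hu` DISCHARGED by ✔ `exists_liuCMRecord_of_cmDatum` applied to the chosen Def. 4.5 (2) datum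
`datum … M.Dμ` and Liu's eigenclass `(α₀, hα₀, hα₀0)` ([Liu2021] proof of Thm. 4.18 l. 2250; at the J-record `α₀ := M.α`), and `hadm`
asking `adm i` of EVERY model CM record with reflex data `(↥K*_μ, Ψ*_μ, M_μ, e_μ, M_μ ⊆ ℂ)` (the shape of ✔ `admLiu_mk` ∕ `admLiu_mk_of_eq`,
which discharge it at `adm i d := d.IsReflexOfTypeG ι₁ Φ'` from `Φ_μ = Φ'`).  HC_CM is NOT proved; «Δ2 BRIDGE CLOSED» is NOT claimed;
nothing here is a display or a pointer move.
[cite: Liu2021, Def. 4.5 (2) (FJcycle.tex l. 1944–1951), Def. 4.3 (2) (l. 1919), proof of Thm. 4.18 (l. 2246–2253), Thm. 4.18 (1) (l. 2239), Rem. 4.17, Lem. 2.4 (1)]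
[cite: Shimura1998, §7.1 Proposition 7 and §8.3 Prop. 28] -/
theorem nonempty_hcmPieces_ofTower_of_cmDatum
    (M : (toThm418Data C (restOne C (AlgHom.id ℚ (L : Type)) ι₁ hμ hw Car Eps epsOf Chi omega rho rhoΩ)).Map43RationalData)
    (Λ : LevelwiseBettiPullback C (AμOne (AlgHom.id ℚ (L : Type)) ι₁ hμ hw Car M.Dμ) M.L M.U)
    (hMP : M.P = PΩOne C (AlgHom.id ℚ (L : Type)) ι₁ hμ hw Car M.Dμ Λ)
    (jH : M.HB →ₗ[ℂ] (LiuDictionary.ofTower hHD hI h₁ h₃ hA V Char Adm Ω PhiMu adm).H)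
    (i : Char) (K : HodgeCM.Level V)
    (rj : Λ.AKQ (C.levelOf K.K) →ₗ[ℚ]
      (picardCMUniverse hHD hI h₁ h₃).Coh ((picardCMUniverse hHD hI h₁ h₃).pms L ι₁ V K) 1)
    (hj : ∀ (z : ℂ) (x : Λ.AKQ (C.levelOf K.K)),
      resTotal hHD hI (ballQuotientUniformisedDatum_of h₁) h₃ hA K
          (jH (M.ι ((Λ.transKQ (C.levelOf K.K)).baseChange ℂ (z ⊗ₜ[ℚ] x)))) = z ⊗ₜ[ℚ] rj x)
    -- ── Liu's eigenclass `α` of `H¹_{B,ι₁}(A_μ ⊗ ℂ; ℂ)` on which `M_μ` acts through `M_μ ⊆ ℂ` (proof of Thm. 4.18, l. 2250) ──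
    (α₀ : letI := ι₁.toAlgebra
      ℂ ⊗[ℚ] bettiCohomology ((AμOne (AlgHom.id ℚ (L : Type)) ι₁ hμ hw Car M.Dμ).baseChange ℂ).X 1)
    (hα₀ : letI := ι₁.toAlgebra; haveI := hμ.numberField_muAlgValueField
      ∀ k : muAlgValueField (L : Type) μ,
        (hOneAlgHom ((AbelianVariety.endAlgebra.mapRingHom
            ((datum (AlgHom.id ℚ (L : Type)) ι₁ hμ hw Car M.Dμ).A.endBaseChange ℂ)).toRingHom.comp
          (datum (AlgHom.id ℚ (L : Type)) ι₁ hμ hw Car M.Dμ).i) k).baseChange ℂ α₀ =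
          ((k : muAlgValueField (L : Type) μ) : ℂ) • α₀)
    (hα₀0 : α₀ ≠ 0)
    (jf : letI := ι₁.toAlgebra
      (C.A (C.levelOf K.K) ⟶ AμOne (AlgHom.id ℚ (L : Type)) ι₁ hμ hw Car M.Dμ) →
        ((pmsRealisation (ballQuotientUniformisedDatum_of h₁) (pmsCode L ι₁ V K)).X ⟶
          ((AμOne (AlgHom.id ℚ (L : Type)) ι₁ hμ hw Car M.Dμ).baseChange ℂ).X))
    (hrj : letI := ι₁.toAlgebra
      ∀ f : C.A (C.levelOf K.K) ⟶ AμOne (AlgHom.id ℚ (L : Type)) ι₁ hμ hw Car M.Dμ,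
        (rj ∘ₗ Λ.phiStarQ (C.levelOf K.K) f).baseChange ℂ M.α = (pull (jf f) 1).baseChange ℂ α₀)
    -- ── S1: every model CM record of Liu's reflex shape `(↥K*_μ, Ψ*_μ, M_μ, e_μ, M_μ ⊆ ℂ)` is admissible at `i` (✔ `admLiu_mk_of_eq`) ──
    (hadm : haveI := hμ.numberField_muAlgValueField
      ∀ (A : AbelianVariety ℂ) (ιA : NumberField.RingOfIntegers ↥(muAlgValueField (L : Type) μ) →+* End A)
        (θA : ↥(muAlgValueField (L : Type) μ) →+* Module.End ℂ (complexBetti A.X 1))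
        (hA' : IsCMTypeRealisation (inducedCMType (Def45.incl (AlgHom.id ℚ (L : Type)) ι₁ hμ)
          (reflexCMType ι₁ hμ.cmType (AlgHom.id ℚ (L : Type)))) A ιA θA)
        (α : ℂ ⊗[ℚ] bettiCohomology A.X 1)
        (hα : α ∈ eigenline (HodgeCM.CM.CommonReflex.complexify (BettiUniverse.cmAction θA hA'.isInducedOnIntegers))
          (muAlgValueField (L : Type) μ).subtype),
        adm i
          { K' := ↥(reflexField ℚ (L : Type) (algValuedIn ι₁ hμ.cmType.1))
            Φ' := (reflexCMType ι₁ hμ.cmType (AlgHom.id ℚ (L : Type))).1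
            M := ↥(muAlgValueField (L : Type) μ)
            instNumberFieldM := hμ.numberField_muAlgValueField
            k := Def45.incl (AlgHom.id ℚ (L : Type)) ι₁ hμ
            A := A, ιA := ιA, θA := θA
            ΦA := inducedCMType (Def45.incl (AlgHom.id ℚ (L : Type)) ι₁ hμ) (reflexCMType ι₁ hμ.cmType (AlgHom.id ℚ (L : Type)))
            hΦA := fun θ => mem_inducedCMType_iff _ _ θ
            isRealisation := hA'
            τ := (muAlgValueField (L : Type) μ).subtype
            α := α, α_mem := hα }) :
    Nonempty (HcmPieces.{0, 1, 0} (toThm418Data C (restOne C (AlgHom.id ℚ (L : Type)) ι₁ hμ hw Car Eps epsOf Chi omega rho rhoΩ)) M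
      (LiuDictionary.ofTower hHD hI h₁ h₃ hA V Char Adm Ω PhiMu adm).H jH K.K
      ((picardCMUniverse hHD hI h₁ h₃).CohC ((picardCMUniverse hHD hI h₁ h₃).pms L ι₁ V K) 1)
      (resTotal hHD hI (ballQuotientUniformisedDatum_of h₁) h₃ hA K)
      ((LiuDictionary.ofTower hHD hI h₁ h₃ hA V Char Adm Ω PhiMu adm).cmClasses K i)) := by
  letI := ι₁.toAlgebra
  haveI := hμ.numberField_muAlgValueField
  -- S1 core (prove-1, ✔ `exists_liuCMRecord_of_cmDatum`) at the chosen datum `datum … M.Dμ` (whose `A` IS `AμOne … M.Dμ`)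
  obtain ⟨B, uB, ιB, θB, hB, α', -, hα', hα'0, huB⟩ :=
    exists_liuCMRecord_of_cmDatum ι₁ (datum (AlgHom.id ℚ (L : Type)) ι₁ hμ hw Car M.Dμ) α₀ hα₀ hα₀0
  refine nonempty_hcmPieces_ofTower V Char Adm Ω PhiMu adm h Φ C (AlgHom.id ℚ (L : Type)) ι₁ hμ hw Car Eps epsOf Chi omega rho
    rhoΩ M Λ hMP jH i K rj hj α₀ jf hrj
    (fun q =>
      { K' := ↥(reflexField ℚ (L : Type) (algValuedIn ι₁ hμ.cmType.1))
        Φ' := (reflexCMType ι₁ hμ.cmType (AlgHom.id ℚ (L : Type))).1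
        M := ↥(muAlgValueField (L : Type) μ)
        instNumberFieldM := hμ.numberField_muAlgValueField
        k := Def45.incl (AlgHom.id ℚ (L : Type)) ι₁ hμ
        A := B, ιA := ιB, θA := θB
        ΦA := inducedCMType (Def45.incl (AlgHom.id ℚ (L : Type)) ι₁ hμ) (reflexCMType ι₁ hμ.cmType (AlgHom.id ℚ (L : Type)))
        hΦA := fun θ => mem_inducedCMType_iff _ _ θ
        isRealisation := hB
        τ := (muAlgValueField (L : Type) μ).subtype
        α := (q : ℂ) • α', α_mem := Submodule.smul_mem _ _ hα' })
    (fun _ => uB.hom.hom.hom) (fun q Y f => ?_)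
    (fun q => hadm B ιB θB hB ((q : ℂ) • α') (Submodule.smul_mem _ _ hα'))
  -- `hu`: `(f ≫ u)^*_ℂ (q • α') = q • f^*_ℂ α₀`
  show (pull (f ≫ uB.hom.hom.hom) 1).baseChange ℂ ((q : ℂ) • α') = (q : ℂ) • (pull f 1).baseChange ℂ α₀
  rw [LinearMap.map_smul]
  exact congrArg (fun v => (q : ℂ) • v) (huB Y f)

end PiecesAtTowerLiu


/-! ## At the RESTS OF RECORD `U.rest (restTailOne …)` (DECISION #8 ∕ #9: the (c) ∕ (d) binders are typed over
`toThm418Data C ((U i hμ hg).rest (tail i hμ hg))` with `tail := restTailOne …`; `restOne C … U.Eps U.epsOf U.Chi (U.omega μ hμ) (U.rho μ hμ) rhoΩ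
= U.rest (restTailOne … rhoΩ)` is `rfl`, ✔ `UniformOmega.restOne_eq_rest` ∕ `toThm418Data_restOne_eq`, `Liu2021/AppendixC/Prop413DataOfRestOne.lean`)
— the two theorems above with ONLY THE CONCLUSION re-typed there (every binder keeps the cheap `restOne` typing of prove-2's
`map43RecordAtPin`; the conclusion's record slot is then inhabited by the same term, as prove-2's `map43RecordAtUniformRest := (map43RecordAtPin … :)`). -/

section PiecesAtTowerRest

open Literature.AlgebraicGeometry.ComplexMultiplication
open Literature.NumberTheory.ComplexMultiplication
open Literature.NumberTheory.Automorphic.IdeleClassGroup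

variable {hHD : exists_isReal_hodgeModel} {hI : hodgePQ_independent_of_hodgeModel}
  {h₁ : BallQuotientUniformised} {h₃ : CMAbelianVarietyRealised} {hA : Arapura2012_Cor_15_4_6}
variable {L : HodgeCM.CMField} {ι₁ : (L : Type) →+* ℂ} (V : HodgeCM.HermSpace3 L ι₁)
variable (Char : Type) (Adm : Char → Type) (Ω : (i : Char) → Adm i → Type)
  [∀ i a, AddCommGroup (Ω i a)] [∀ i a, Module ℂ (Ω i a)] [∀ i a, Module (adelicAlgebra V) (Ω i a)]
  [∀ i a, IsScalarTower ℂ (adelicAlgebra V) (Ω i a)] (PhiMu : Char → Prop) (adm : Char → LiuCMSide → Prop)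
variable (h : exists_recordSystem) (Φ : Literature.AlgebraicGeometry.Motives.CMType L) {isotropicAt : ℕ → Prop}
  (C : Sec42Data (Model.honestP5Of h ⟨L.K⟩ ι₁ ⟨V.Hm, V.isHermitian, V.signature_ι₁, V.posDef_of_ne⟩ Φ) isotropicAt)
variable {Lg : Type} [Field Lg] [NumberField Lg] [IsGalois ℚ Lg] (emb : (L : Type) →ₐ[ℚ] Lg) (ιg : Lg →+* ℂ)
  {μ : Literature.NumberTheory.Automorphic.IdeleClassGroup (L : Type) →ₜ* Circle}
  (hμ : Literature.NumberTheory.Automorphic.IdeleClassGroup.IsConjugateSymplectic (L : Type) μ)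
  (hw : Literature.NumberTheory.Automorphic.IdeleClassGroup.HasWeight (L : Type) μ 1) (Car : Def45.Carriers (L : Type) μ)
  (U : UniformOmega C)

set_option maxHeartbeats 1600000 in
-- (one definitional re-typing `toThm418Data C (restOne …) ≡ toThm418Data C (U.rest (restTailOne …))` of a large structure type; no search)
/-- **Δ2 BRIDGE, PIN (d) at the rests of record `U.rest (restTailOne …)`** — `nonempty_hcmPieces_ofTower` (generic S1 binders) with its
CONCLUSION re-typed along `restOne C … U.Eps U.epsOf U.Chi (U.omega μ hμ) (U.rho μ hμ) rhoΩ = U.rest (restTailOne … rhoΩ)` (`rfl`); the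
binders keep the `restOne` typing (prove-2's `map43RecordAtPin`).  HC_CM is NOT proved; «Δ2 BRIDGE CLOSED» is NOT claimed.
[cite: Liu2021, Thm. 4.18 (1) (FJcycle.tex l. 2239), Rem. 4.17, proof of Thm. 4.18 map (4.2)/(4.3) (l. 2247–2253), Lem. 2.4 (1), Def. 4.5 (2), Def. 4.11, Def. 4.16] -/
theorem nonempty_hcmPieces_ofTower_rest [Algebra (L : Type) ℂ]
    (rhoΩ : Representation (fieldOfValues (L : Type) μ) C.G (ΩOne C emb ιg hμ hw Car))
    (M : (toThm418Data C (restOne C emb ιg hμ hw Car U.Eps U.epsOf U.Chi (U.omega μ hμ) (U.rho μ hμ) rhoΩ)).Map43RationalData)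
    (Λ : LevelwiseBettiPullback C (AμOne emb ιg hμ hw Car M.Dμ) M.L M.U)
    (hMP : M.P = PΩOne C emb ιg hμ hw Car M.Dμ Λ)
    (jH : M.HB →ₗ[ℂ] (LiuDictionary.ofTower hHD hI h₁ h₃ hA V Char Adm Ω PhiMu adm).H)
    (i : Char) (K : HodgeCM.Level V)
    (rj : Λ.AKQ (C.levelOf K.K) →ₗ[ℚ]
      (picardCMUniverse hHD hI h₁ h₃).Coh ((picardCMUniverse hHD hI h₁ h₃).pms L ι₁ V K) 1)
    (hj : ∀ (z : ℂ) (x : Λ.AKQ (C.levelOf K.K)),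
      resTotal hHD hI (ballQuotientUniformisedDatum_of h₁) h₃ hA K
          (jH (M.ι ((Λ.transKQ (C.levelOf K.K)).baseChange ℂ (z ⊗ₜ[ℚ] x)))) = z ⊗ₜ[ℚ] rj x)
    (α₀ : ℂ ⊗[ℚ] bettiCohomology ((AμOne emb ιg hμ hw Car M.Dμ).baseChange ℂ).X 1)
    (jf : (C.A (C.levelOf K.K) ⟶ AμOne emb ιg hμ hw Car M.Dμ) →
      ((pmsRealisation (ballQuotientUniformisedDatum_of h₁) (pmsCode L ι₁ V K)).X ⟶
        ((AμOne emb ιg hμ hw Car M.Dμ).baseChange ℂ).X))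
    (hrj : ∀ f : C.A (C.levelOf K.K) ⟶ AμOne emb ιg hμ hw Car M.Dμ,
      (rj ∘ₗ Λ.phiStarQ (C.levelOf K.K) f).baseChange ℂ M.α = (pull (jf f) 1).baseChange ℂ α₀)
    (dLiu : ℚ → LiuCMSide)
    (u : ∀ q : ℚ, ((AμOne emb ιg hμ hw Car M.Dμ).baseChange ℂ).X ⟶ (dLiu q).A.X)
    (hu : ∀ (q : ℚ) (Y : SchemeOver ℂ) (f : Y ⟶ ((AμOne emb ιg hμ hw Car M.Dμ).baseChange ℂ).X),
      (pull (f ≫ u q) 1).baseChange ℂ (dLiu q).α = (q : ℂ) • (pull f 1).baseChange ℂ α₀)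
    (hadm : ∀ q : ℚ, adm i (dLiu q)) :
    Nonempty (HcmPieces.{0, 1, 0} (toThm418Data C (U.rest (restTailOne emb ιg hμ hw Car rhoΩ)))
      (M : (toThm418Data C (U.rest (restTailOne emb ιg hμ hw Car rhoΩ))).Map43RationalData)
      (LiuDictionary.ofTower hHD hI h₁ h₃ hA V Char Adm Ω PhiMu adm).H jH K.K
      ((picardCMUniverse hHD hI h₁ h₃).CohC ((picardCMUniverse hHD hI h₁ h₃).pms L ι₁ V K) 1)
      (resTotal hHD hI (ballQuotientUniformisedDatum_of h₁) h₃ hA K)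
      ((LiuDictionary.ofTower hHD hI h₁ h₃ hA V Char Adm Ω PhiMu adm).cmClasses K i)) :=
  nonempty_hcmPieces_ofTower V Char Adm Ω PhiMu adm h Φ C emb ιg hμ hw Car U.Eps U.epsOf U.Chi (U.omega μ hμ) (U.rho μ hμ)
    rhoΩ M Λ hMP jH i K rj hj α₀ jf hrj dLiu u hu hadm

set_option maxHeartbeats 1600000 in
-- (same single definitional re-typing of the conclusion; no search)
/-- **Δ2 BRIDGE, PIN (d) at the rests of record `U.rest (restTailOne …)`, S1 DISCHARGED** — `nonempty_hcmPieces_ofTower_of_cmDatum` with its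
CONCLUSION re-typed along the same `rfl` (pin values `emb := AlgHom.id ℚ L`, `ιg := ι₁`, base change along `ι₁`; binders keep the `restOne`
typing).  HC_CM is NOT proved; «Δ2 BRIDGE CLOSED» is NOT claimed.
[cite: Liu2021, Def. 4.5 (2) (FJcycle.tex l. 1944–1951), proof of Thm. 4.18 (l. 2246–2253), Thm. 4.18 (1), Rem. 4.17, Lem. 2.4 (1), Def. 4.11, Def. 4.16]
[cite: Shimura1998, §7.1 Proposition 7 and §8.3 Prop. 28] -/
theorem nonempty_hcmPieces_ofTower_rest_of_cmDatum [IsGalois ℚ (L : Type)]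
    (rhoΩ : Representation (fieldOfValues (L : Type) μ) C.G (ΩOne C (AlgHom.id ℚ (L : Type)) ι₁ hμ hw Car))
    (M : (toThm418Data C (restOne C (AlgHom.id ℚ (L : Type)) ι₁ hμ hw Car U.Eps U.epsOf U.Chi (U.omega μ hμ) (U.rho μ hμ)
      rhoΩ)).Map43RationalData)
    (Λ : LevelwiseBettiPullback C (AμOne (AlgHom.id ℚ (L : Type)) ι₁ hμ hw Car M.Dμ) M.L M.U)
    (hMP : M.P = PΩOne C (AlgHom.id ℚ (L : Type)) ι₁ hμ hw Car M.Dμ Λ)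
    (jH : M.HB →ₗ[ℂ] (LiuDictionary.ofTower hHD hI h₁ h₃ hA V Char Adm Ω PhiMu adm).H)
    (i : Char) (K : HodgeCM.Level V)
    (rj : Λ.AKQ (C.levelOf K.K) →ₗ[ℚ]
      (picardCMUniverse hHD hI h₁ h₃).Coh ((picardCMUniverse hHD hI h₁ h₃).pms L ι₁ V K) 1)
    (hj : ∀ (z : ℂ) (x : Λ.AKQ (C.levelOf K.K)),
      resTotal hHD hI (ballQuotientUniformisedDatum_of h₁) h₃ hA K
          (jH (M.ι ((Λ.transKQ (C.levelOf K.K)).baseChange ℂ (z ⊗ₜ[ℚ] x)))) = z ⊗ₜ[ℚ] rj x)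
    (α₀ : letI := ι₁.toAlgebra
      ℂ ⊗[ℚ] bettiCohomology ((AμOne (AlgHom.id ℚ (L : Type)) ι₁ hμ hw Car M.Dμ).baseChange ℂ).X 1)
    (hα₀ : letI := ι₁.toAlgebra; haveI := hμ.numberField_muAlgValueField
      ∀ k : muAlgValueField (L : Type) μ,
        (hOneAlgHom ((AbelianVariety.endAlgebra.mapRingHom
            ((datum (AlgHom.id ℚ (L : Type)) ι₁ hμ hw Car M.Dμ).A.endBaseChange ℂ)).toRingHom.comp
          (datum (AlgHom.id ℚ (L : Type)) ι₁ hμ hw Car M.Dμ).i) k).baseChange ℂ α₀ =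
          ((k : muAlgValueField (L : Type) μ) : ℂ) • α₀)
    (hα₀0 : α₀ ≠ 0)
    (jf : letI := ι₁.toAlgebra
      (C.A (C.levelOf K.K) ⟶ AμOne (AlgHom.id ℚ (L : Type)) ι₁ hμ hw Car M.Dμ) →
        ((pmsRealisation (ballQuotientUniformisedDatum_of h₁) (pmsCode L ι₁ V K)).X ⟶
          ((AμOne (AlgHom.id ℚ (L : Type)) ι₁ hμ hw Car M.Dμ).baseChange ℂ).X))
    (hrj : letI := ι₁.toAlgebra
      ∀ f : C.A (C.levelOf K.K) ⟶ AμOne (AlgHom.id ℚ (L : Type)) ι₁ hμ hw Car M.Dμ,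
        (rj ∘ₗ Λ.phiStarQ (C.levelOf K.K) f).baseChange ℂ M.α = (pull (jf f) 1).baseChange ℂ α₀)
    (hadm : haveI := hμ.numberField_muAlgValueField
      ∀ (A : AbelianVariety ℂ) (ιA : NumberField.RingOfIntegers ↥(muAlgValueField (L : Type) μ) →+* End A)
        (θA : ↥(muAlgValueField (L : Type) μ) →+* Module.End ℂ (complexBetti A.X 1))
        (hA' : IsCMTypeRealisation (inducedCMType (Def45.incl (AlgHom.id ℚ (L : Type)) ι₁ hμ)
          (reflexCMType ι₁ hμ.cmType (AlgHom.id ℚ (L : Type)))) A ιA θA)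
        (α : ℂ ⊗[ℚ] bettiCohomology A.X 1)
        (hα : α ∈ eigenline (HodgeCM.CM.CommonReflex.complexify (BettiUniverse.cmAction θA hA'.isInducedOnIntegers))
          (muAlgValueField (L : Type) μ).subtype),
        adm i
          { K' := ↥(reflexField ℚ (L : Type) (algValuedIn ι₁ hμ.cmType.1))
            Φ' := (reflexCMType ι₁ hμ.cmType (AlgHom.id ℚ (L : Type))).1
            M := ↥(muAlgValueField (L : Type) μ)
            instNumberFieldM := hμ.numberField_muAlgValueField
            k := Def45.incl (AlgHom.id ℚ (L : Type)) ι₁ hμ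
            A := A, ιA := ιA, θA := θA
            ΦA := inducedCMType (Def45.incl (AlgHom.id ℚ (L : Type)) ι₁ hμ) (reflexCMType ι₁ hμ.cmType (AlgHom.id ℚ (L : Type)))
            hΦA := fun θ => mem_inducedCMType_iff _ _ θ
            isRealisation := hA'
            τ := (muAlgValueField (L : Type) μ).subtype
            α := α, α_mem := hα }) :
    Nonempty (HcmPieces.{0, 1, 0}
      (toThm418Data C (U.rest (restTailOne (AlgHom.id ℚ (L : Type)) ι₁ hμ hw Car rhoΩ)))
      (M : (toThm418Data C (U.rest (restTailOne (AlgHom.id ℚ (L : Type)) ι₁ hμ hw Car rhoΩ))).Map43RationalData)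
      (LiuDictionary.ofTower hHD hI h₁ h₃ hA V Char Adm Ω PhiMu adm).H jH K.K
      ((picardCMUniverse hHD hI h₁ h₃).CohC ((picardCMUniverse hHD hI h₁ h₃).pms L ι₁ V K) 1)
      (resTotal hHD hI (ballQuotientUniformisedDatum_of h₁) h₃ hA K)
      ((LiuDictionary.ofTower hHD hI h₁ h₃ hA V Char Adm Ω PhiMu adm).cmClasses K i)) :=
  nonempty_hcmPieces_ofTower_of_cmDatum V Char Adm Ω PhiMu adm h Φ C hμ hw Car U.Eps U.epsOf U.Chi (U.omega μ hμ)
    (U.rho μ hμ) rhoΩ M Λ hMP jH i K rj hj α₀ hα₀ hα₀0 jf hrj hadm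

end PiecesAtTowerRest

end Summit.HodgeConjecture.CorCM.D2Bridge

end
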